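import Mathlib
import Summits.Ventures.HodgeRepro.Tier4.Common.CornerHolo

/-!
# Tier4/Common/RelCompact — relative compactness of a domain in the `nsq ≤ r < 1` form, and `P_T4_of_concrete` in
that form

Blind re-derivation cell `pub-hodge-repro`, Tier 4 (README §9–§10), seat t4-typer-1 (gen 0).  Target tree path
`lean/Summits/Ventures/HodgeRepro/Tier4/Common/RelCompact.lean`.  Imports `Tier4/Common/CornerHolo.lean`.

WHAT IS PROVED.  `closure_subset_ball_of_nsq_le`: a domain with `nsq z ≤ r < 1` on it has closure inside the ball
(the form of relative compactness the lines' `domain` definitions use, e.g. L3's `∃ r < 1, ∀ z ∈ D, nsq z ≤ r`);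
`residual_of_nsq`, `conclusion_of_concrete_P_nsq`, **`P_T4_of_concrete_nsq`**: the `CornerHolo` results restated
with that hypothesis in place of `closure D ⊆ ball`.

Nothing here says anything about the status of the Hodge conjecture for CM abelian varieties, which is NOT proved
(HC_CM is NOT proved by anyone in this repository).
-/

set_option autoImplicit false

noncomputable section

open Matrix MeasureTheory NumberField Set
open scoped ComplexConjugate ComplexOrder

namespace Summit.Ventures.HodgeRepro.Tier4

open Summit.Ventures.HodgeRepro.Tier4.Common

/-- A domain on which `nsq ≤ r < 1` has its closure inside the ball. -/
theorem closure_subset_ball_of_nsq_le {D : Set (Fin 2 → ℂ)} {r : ℝ} (hr : r < 1) (hD : ∀ z ∈ D, nsq z ≤ r) :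
    closure D ⊆ ball := by
  have hclosed : IsClosed {z : Fin 2 → ℂ | nsq z ≤ r} := isClosed_le continuous_nsq continuous_const
  have hsub : closure D ⊆ {z : Fin 2 → ℂ | nsq z ≤ r} := closure_minimal (fun z hz => hD z hz) hclosed
  intro z hz
  exact lt_of_le_of_lt (hsub hz) hr

namespace TargetData

variable {F E : Type} [Field F] [NumberField F] [IsGalois ℚ F] [IsCMField F]
  [Field E] [NumberField E] [IsGalois ℚ E] [IsCMField E] (d : TargetData F E)

/-- The residual bundle from (T2) alone, with relative compactness in the `nsq ≤ r < 1` form. -/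
theorem residual_of_nsq {Γ' : Set (Matrix (Fin 3) (Fin 3) E)} (hΓ' : d.IsLevel Γ') {D : Set (Fin 2 → ℂ)}
    (hDom : d.IsDomain Γ' D) {r : ℝ} (hr : r < 1) (hD : ∀ z ∈ D, nsq z ≤ r)
    (hfin : FiniteDimensional ℂ (d.HForm Γ' D)) : d.ConcreteResidual Γ' D :=
  d.residual_of' hΓ' hDom (closure_subset_ball_of_nsq_le hr hD) hfin

/-- (P) for the concrete witness gives the conclusion of `P_T4`, relative compactness in the `nsq ≤ r < 1` form. -/
theorem conclusion_of_concrete_P_nsq {Γ' : Set (Matrix (Fin 3) (Fin 3) E)} (hΓ' : d.IsLevel Γ') {D : Set (Fin 2 → ℂ)}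
    (hDom : d.IsDomain Γ' D) {r : ℝ} (hr : r < 1) (hD : ∀ z ∈ D, nsq z ≤ r)
    (hfin : FiniteDimensional ℂ (d.HForm Γ' D))
    (hP : (d.concreteWitness hΓ' hDom.subset_ball hDom.measurableSet (d.residual_of_nsq hΓ' hDom hr hD hfin)).P) :
    d.conclusion :=
  d.conclusion_of_concrete_P hΓ' hDom _ hP

end TargetData

/-- **`P_T4` modulo Cartan–Serre**, relative compactness in the `nsq ≤ r < 1` form. -/
theorem P_T4_of_concrete_nsq
    (h : ∀ (F E : Type) [Field F] [NumberField F] [IsGalois ℚ F] [IsCMField F]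
      [Field E] [NumberField E] [IsGalois ℚ E] [IsCMField E] (d : TargetData F E),
      ∃ (Γ' : Set (Matrix (Fin 3) (Fin 3) E)) (hΓ' : d.IsLevel Γ') (D : Set (Fin 2 → ℂ)) (hDom : d.IsDomain Γ' D)
        (r : ℝ) (hr : r < 1) (hD : ∀ z ∈ D, nsq z ≤ r) (hfin : FiniteDimensional ℂ (d.HForm Γ' D)),
        (d.concreteWitness hΓ' hDom.subset_ball hDom.measurableSet (d.residual_of_nsq hΓ' hDom hr hD hfin)).P) :
    P_T4 := by
  refine P_T4_of_forall fun F E _ _ _ _ _ _ _ _ d => ?_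
  obtain ⟨Γ', hΓ', D, hDom, r, hr, hD, hfin, hP⟩ := h F E d
  exact d.conclusion_of_concrete_P_nsq hΓ' hDom hr hD hfin hP

end Summit.Ventures.HodgeRepro.Tier4
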